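import Summits.CriticalPhenomena.PercolationContinuityZ3.Theorems.PercNearOneGluingNoHeavyLowerTailSunflowerMultiPetalKempeMarkedLemmaB
import Summits.CriticalPhenomena.PercolationContinuityZ3.Theorems.PercNearOneGluingNoHeavyLowerTailSunflowerMultiPetalKempeMarkedEdgeMark
import HarnessLib
import HarnessLib.Audit

/-!
# `NoHeavyLowerTail` (crux stmt-CriticalPhenomena-4575), marked multigraphs: the TERMINAL-WEIGHTED two-terminal functional `TI`
# ('a vertex coloured like a terminal is half a mark at that terminal') — definitions, terminal symmetry, the bridge to
# `T(K/su)`, and the two pointwise cases of the induction for THEOREM TI2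

Support file (seat `prim-l12-p2` gen 52; `--supports stmt-CriticalPhenomena-4575`; first file of the kernel-checked port of THEOREM TI2 of
run/shared/lean/prim/prim-l12/prim-l12-p2/FINDING-g51-TI-HIERARCHY.md §9 / PROOF-TI2-MARKED-MULTIGRAPHS-g51.md).  No `sorry`; nothing is asserted
about the crux.

THEOREM TI2 (memo §9): for every marked multigraph `K`, terminals `u ≠ v` and a vertex `s ∉ {u,v}`,  `T(K/su) ≤ T(K) + T(K + us)` — identifying a
vertex INTO a terminal (not a monotone operation: `T(K/su) ≤ T(K)` fails) costs at most the two-terminal functional of `K` with one more edge `us`.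
Equivalently `2·T(K) + T((K/su)⁺ᵘ) ≥ 2·T(K/su)`, equivalently `TI(K) := Σ_{σ u = 0, σ v = 1} h(σ) ≥ 0` with `h(σ) = 2·fC(type σ)` if `σ s ≠ 0` and
`fC(type σ ⊕ e₀)` if `σ s = 0`: a vertex coloured like the terminal `u` acts as HALF A MARK at `u` (the first rung of the TI hierarchy of the memo).
This file:
* `hWt c t z` — the weighted kernel for weight colour `c` (`c = 0`: half mark at `u`; `c = 1`: half mark at `v`), `MGraph.TIfun c s u v`;
* `TIfun_swap` — terminal symmetry `TI₀(K; s,u,v) = TI₁(K; s,v,u)` (global colour swap `0 ↔ 1`), which turns every `v`-side case of the induction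
  into a `u`-side case for the other weight colour;
* `three_mul_TIfun_eq` — THE BRIDGE `3·TI₀(K) = 6·T(K) + T((K/su)⁺ᵘ) − 2·T(K/su)` (contraction realised on `V`, `s` free; p631901's
  `TfunM_contractOne_eq`/`TfunM_addMark_contractOne`), and `TfunM_contractOne_le_of_TIfun_nonneg` — TI2 from `TI₀ ≥ 0` via (MM_T);
* `sum_nonneg_of_charging` — the abstract charging lemma (deficits injectively charged to payers) used by every pairing step of the port;
* **`TIfun_nonneg_of_mark`** — the MARKED-FIRST-TERMINAL case (memo §9 (b)): if `mark u ≠ 0` then `TI_c(K; s,u,v) ≥ 0` for both weight colours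
  (deficit cells: type `(1,0,1)` with `σ s ≠ c`, value `−2`; `Φ_u` maps them injectively onto type-`(2,0,0)` cells of value `≥ 2`).
-/

namespace Summit.CriticalPhenomena.PercolationContinuityZ3.Theorems.SunflowerPartition.Kempe

open Finset

/-! ## The weighted kernel (finite tables) -/

/-- The TERMINAL-WEIGHTED two-terminal kernel for weight colour `c`: a special vertex of colour `c` is half a mark at the `c`-coloured terminal
(`fC (t ⊕ e_c)`, weight `1`), otherwise the plain kernel with weight `2`. [this work] -/
def hWt (c : Fin 3) (t : CType) (z : Fin 3) : ℤ := if z = c then fC (ctAdd t (xPart c (1, 1, 1))) else 2 * fC t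

/-- Terminal symmetry of the weighted kernel: weight colour `1` read through the colour swap `0 ↔ 1` is weight colour `0`. (finite check) [this work] -/
theorem hWt_swap01 : ∀ (t : CType) (z : Fin 3), hWt 1 (t.2.1, t.1, t.2.2) (sw01 z) = hWt 0 t z := by decide

/-- With a marked first terminal (`t.1 ≠ 0`) the only negative weighted cells are type `(1,0,1)` with the special vertex not of the weight colour,
value `−2` (`c ∈ {0,1}`). (finite check) [this work] -/
theorem hWt_neg_of_fst_ne_zero : ∀ (c : Fin 3) (t : CType) (z : Fin 3), (c = 0 ∨ c = 1) → t.1 ≠ 0 → hWt c t z < 0 →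
    z ≠ c ∧ t = (1, 0, 1) ∧ hWt c t z = -2 := by decide

/-- The payer cells of the marked-terminal case: type `(2,0,0)` with the swapped special colour has weighted value `≥ 2`. (finite check) [this work] -/
theorem two_le_hWt_payer : ∀ (c z : Fin 3), (c = 0 ∨ c = 1) → z ≠ c → 2 ≤ hWt c (2, 0, 0) (sw02 z) := by decide

/-- The swap partner of a type-`(1,0,1)` colouring at a marked terminal has type `(2,0,0)` (base-type bookkeeping of `ctypeM_pair`). (finite check) [this work] -/
theorem pair_type_200 : ∀ Ia Ic P P' B₁ : Fin 3, P ≠ 0 → P' ≠ 0 → capAdd Ia P = 1 → B₁ = 0 → Ic = 1 →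
    capAdd Ic P' = 2 ∧ Ia = 0 := by decide

/-- `(cap3 1, cap3 1, cap3 1) = (1,1,1)`. [this work] -/
theorem cap3_one_triple : ((cap3 1, cap3 1, cap3 1) : CType) = (1, 1, 1) := by decide

/-! ## The abstract charging lemma -/

/-- **CHARGING**: if every negative term of a finite sum is charged, injectively, to a term at least as large in absolute value, the sum is nonnegative.
[this work] -/
theorem sum_nonneg_of_charging {α : Type*} [DecidableEq α] (F : Finset α) (f : α → ℤ) (ψ : α → α)
    (hpay : ∀ ρ ∈ F, f ρ < 0 → ψ ρ ∈ F ∧ -f ρ ≤ f (ψ ρ))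
    (hinj : Set.InjOn ψ ↑(F.filter fun ρ => f ρ < 0)) : 0 ≤ ∑ ρ ∈ F, f ρ := by
  set D := F.filter (fun ρ => f ρ < 0) with hD
  have hDsub : D ⊆ F := filter_subset _ _
  have memD : ∀ ρ, ρ ∈ D ↔ ρ ∈ F ∧ f ρ < 0 := fun ρ => by rw [hD, mem_filter]
  have hsplit : ∑ ρ ∈ F, f ρ = ∑ ρ ∈ D, f ρ + ∑ ρ ∈ F \ D, f ρ := by
    rw [← sum_sdiff hDsub, add_comm]
  have himg_sub : D.image ψ ⊆ F \ D := by
    intro σ hσ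
    rw [mem_image] at hσ
    obtain ⟨ρ, hρ, rfl⟩ := hσ
    obtain ⟨hρF, hρneg⟩ := (memD ρ).1 hρ
    obtain ⟨hF1, h1⟩ := hpay ρ hρF hρneg
    rw [mem_sdiff]
    refine ⟨hF1, fun hmem => ?_⟩
    have hlt := ((memD _).1 hmem).2
    omega
  have hrest_nonneg : ∀ ρ ∈ F \ D, 0 ≤ f ρ := fun ρ hρ => by
    have hρF := (mem_sdiff.1 hρ).1
    have hρD := (mem_sdiff.1 hρ).2
    by_contra hlt; push Not at hlt
    exact hρD ((memD ρ).2 ⟨hρF, hlt⟩)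
  have h2 : ∑ σ ∈ D.image ψ, f σ ≤ ∑ ρ ∈ F \ D, f ρ :=
    sum_le_sum_of_subset_of_nonneg himg_sub (fun ρ hρ _ => hrest_nonneg ρ hρ)
  have h3 : ∑ σ ∈ D.image ψ, f σ = ∑ ρ ∈ D, f (ψ ρ) := sum_image (fun a ha b hb h => hinj ha hb h)
  have h4 : ∑ ρ ∈ D, (-f ρ) ≤ ∑ ρ ∈ D, f (ψ ρ) :=
    sum_le_sum fun ρ hρ => (hpay ρ ((memD ρ).1 hρ).1 ((memD ρ).1 hρ).2).2
  have h5 : ∑ ρ ∈ D, (-f ρ) = -∑ ρ ∈ D, f ρ := by simp only [sum_neg_distrib]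
  rw [hsplit]
  linarith

namespace MGraph

variable {V : Type*} [Fintype V] [LinearOrder V] (K : MGraph V)

/-! ## The weighted functional, terminal symmetry, and the bridge to `T(K/su)` -/

section Defs

/-- **The terminal-weighted two-terminal functional** `TI_c(K; s,u,v) = Σ_{σ u = 0, σ v = 1} hWt c (type σ) (σ s)` (weight colour `c`;
`TI₀ = T̃ˢ` of the memo: `2·fC` off `σ s = 0`, `fC(type ⊕ e₀)` on `σ s = 0`). [this work] -/
def TIfun (c : Fin 3) (s u v : V) : ℤ := ∑ σ ∈ univ.filter (fun σ : V → Fin 3 => σ u = 0 ∧ σ v = 1), hWt c (K.ctypeM σ) (σ s)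

/-- **Terminal symmetry**: `TI₀(K; s,u,v) = TI₁(K; s,v,u)` — a half mark at the first terminal is a half mark at the second terminal of the
reversed pair (global colour swap `0 ↔ 1`). [this work] -/
theorem TIfun_swap (s u v : V) : K.TIfun 0 s u v = K.TIfun 1 s v u := by
  unfold TIfun
  refine sum_nbij' (fun σ w => sw01 (σ w)) (fun σ w => sw01 (σ w)) (fun σ hσ => ?_) (fun σ hσ => ?_)
    (fun σ _ => funext fun w => sw01_sw01 (σ w)) (fun σ _ => funext fun w => sw01_sw01 (σ w)) (fun σ _ => ?_)
  · rw [mem_filter] at hσ ⊢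
    refine ⟨mem_univ _, ?_, ?_⟩
    · simp only [hσ.2.2]; decide
    · simp only [hσ.2.1]; decide
  · rw [mem_filter] at hσ ⊢
    refine ⟨mem_univ _, ?_, ?_⟩
    · simp only [hσ.2.2]; decide
    · simp only [hσ.2.1]; decide
  · rw [K.ctypeM_sw01 σ]
    exact (hWt_swap01 _ _).symm

/-- `TI₀` split along the colour of `s`: the half-marked part is the two-terminal sum of `K⁺ᵘ` over `σ s = σ u`, the rest twice that of `K`. [this work] -/
theorem TIfun_zero_eq_split (s u v : V) :
    K.TIfun 0 s u v
      = ∑ σ ∈ univ.filter (fun σ : V → Fin 3 => (σ u = 0 ∧ σ v = 1) ∧ σ u = σ s), fC ((K.addMark u 1).ctypeM σ)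
        + 2 * ∑ σ ∈ univ.filter (fun σ : V → Fin 3 => (σ u = 0 ∧ σ v = 1) ∧ ¬ σ u = σ s), fC (K.ctypeM σ) := by
  unfold TIfun
  rw [← sum_filter_add_sum_filter_not (univ.filter (fun σ : V → Fin 3 => σ u = 0 ∧ σ v = 1)) (fun σ : V → Fin 3 => σ u = σ s),
    filter_filter, filter_filter, mul_sum]
  congr 1
  · refine sum_congr rfl fun σ hσ => ?_
    obtain ⟨-, ⟨hu, -⟩, hus⟩ := mem_filter.1 hσ
    unfold hWt
    rw [if_pos (by rw [← hus, hu]), K.ctypeM_addMark u 1 σ, hu, cap3_one_triple]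
  · refine sum_congr rfl fun σ hσ => ?_
    obtain ⟨-, ⟨hu, -⟩, hus⟩ := mem_filter.1 hσ
    unfold hWt
    rw [if_neg (fun h => hus (by rw [h, hu]))]

/-- **THE BRIDGE** `3·TI₀(K; s,u,v) = 6·T(K) + T((K/su)⁺ᵘ) − 2·T(K/su)` (the contraction of `s` into `u` realised on `V` with `s` free, whence the `3`). [this work] -/
theorem three_mul_TIfun_eq (s u v : V) (hsu : s ≠ u) (hsv : s ≠ v) :
    3 * K.TIfun 0 s u v = 6 * K.TfunM u v + ((K.contractOne s u).addMark u 1).TfunM u v - 2 * (K.contractOne s u).TfunM u v := by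
  rw [K.TIfun_zero_eq_split s u v, K.TfunM_addMark_contractOne u v u s hsu.symm hsu hsv, K.TfunM_contractOne_eq u v u s hsu.symm hsu hsv]
  have hT : K.TfunM u v = ∑ σ ∈ univ.filter (fun σ : V → Fin 3 => (σ u = 0 ∧ σ v = 1) ∧ σ u = σ s), fC (K.ctypeM σ)
      + ∑ σ ∈ univ.filter (fun σ : V → Fin 3 => (σ u = 0 ∧ σ v = 1) ∧ ¬ σ u = σ s), fC (K.ctypeM σ) := by
    unfold TfunM
    rw [← sum_filter_add_sum_filter_not (univ.filter (fun σ : V → Fin 3 => σ u = 0 ∧ σ v = 1)) (fun σ : V → Fin 3 => σ u = σ s),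
      filter_filter, filter_filter]
  rw [hT]
  ring

/-- **THEOREM TI2 from `TI₀ ≥ 0`**: `T(K/su) ≤ 3·(T(K) + T(K + us))` on `V` (`s` free on the left), i.e. `T(K/su) ≤ T(K) + T(K+us)` — by the bridge and
the member–mark identity (MM_T) of p631901. [this work] -/
theorem TfunM_contractOne_le_of_TIfun_nonneg (s u v : V) (hsu : s ≠ u) (hsv : s ≠ v) (h : 0 ≤ K.TIfun 0 s u v) :
    (K.contractOne s u).TfunM u v
      ≤ 3 * (K.TfunM u v + (K.addAtU u (fun w => if w = s then 1 else 0) (if_neg hsu.symm) 0).TfunM u v) := by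
  have h1 := K.three_mul_TIfun_eq s u v hsu hsv
  have h2 := K.three_mul_TfunM_addEdge_sub u v u s hsu.symm hsu hsv
  linarith

end Defs

/-! ## The marked-first-terminal case (memo §9 (b)) -/

section MarkedTerminal

/-- **MARKED FIRST TERMINAL**: if `mark u ≠ 0` then `TI_c(K; s,u,v) ≥ 0` for both weight colours `c ∈ {0,1}` (`s ∉ {u,v}`).  Deficit cells have type
`(1,0,1)` and `σ s ≠ c` (value `−2`); the swap `Φ_u` (colours `0 ↔ 2` off `u`) maps them injectively to type-`(2,0,0)` cells of value `≥ 2`. [this work] -/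
theorem TIfun_nonneg_of_mark (c : Fin 3) (hc : c = 0 ∨ c = 1) (s u v : V) (huv : u ≠ v) (hsu : s ≠ u) (hm : K.mark u ≠ 0) :
    0 ≤ K.TIfun c s u v := by
  unfold TIfun
  set F := univ.filter (fun σ : V → Fin 3 => σ u = 0 ∧ σ v = 1) with hF
  have memF : ∀ ρ, ρ ∈ F ↔ ρ u = 0 ∧ ρ v = 1 := fun ρ => by rw [hF, mem_filter]; simp
  refine sum_nonneg_of_charging F (fun ρ => hWt c (K.ctypeM ρ) (ρ s)) (phiU u) (fun ρ hρ hneg => ?_) (fun ρ₁ _ ρ₂ _ h => ?_)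
  · obtain ⟨hu, hv⟩ := (memF ρ).1 hρ
    have hφu : phiU u ρ u = 0 := by rw [phiU_self, hu]
    have hφv : phiU u ρ v = 1 := by rw [phiU_of_ne u ρ huv.symm, hv]; decide
    have h1 : (K.ctypeM ρ).1 ≠ 0 := K.ctypeM_fst_ne_zero_of_mark u ρ hu hm
    obtain ⟨hzc, ht, hval⟩ := hWt_neg_of_fst_ne_zero c _ _ hc h1 hneg
    obtain ⟨t1, t2⟩ := K.ctypeM_pair u ρ hu
    have hP : cap3 (K.linkM u ρ 0 + K.mark u) ≠ 0 := cap3_ne_zero (by omega)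
    have hP' : cap3 (K.linkM u ρ 2 + K.mark u) ≠ 0 := cap3_ne_zero (by omega)
    have h101 := t1.symm.trans ht
    simp only [Prod.mk.injEq] at h101
    have h200 : K.ctypeM (phiU u ρ) = (2, 0, 0) := by
      obtain ⟨e1, e2⟩ := pair_type_200 _ _ _ _ _ hP hP' h101.1 h101.2.1 h101.2.2
      rw [t2, e1, e2, h101.2.1]
    refine ⟨(memF _).2 ⟨hφu, hφv⟩, ?_⟩
    rw [hval, h200, phiU_of_ne u ρ hsu]
    have := two_le_hWt_payer c (ρ s) hc hzc
    linarith
  · have := congrArg (phiU u) h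
    rwa [phiU_phiU, phiU_phiU] at this

end MarkedTerminal

end MGraph

end Summit.CriticalPhenomena.PercolationContinuityZ3.Theorems.SunflowerPartition.Kempe
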